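import Summits.BirchSwinnertonDyer.BirchSwinnertonDyer.Theses.CountingDoorF2AtThree
import Summits.BirchSwinnertonDyer.Rank2.F2DensityAlgebra
import Literature.NumberTheory.EllipticCurves.KummerMap
import Literature.NumberTheory.EllipticCurves.PointDivisibilityProofs
import HarnessLib

/-!
# BirchSwinnertonDyer / CountingDoorF2AtThree — support lemmas for crux I1
# `SelmerThreeAverageLargeF2` (stmt-BirchSwinnertonDyer-19440): the count interface and the
# marked-point split `36 = 9 + 27`

Route `route-BirchSwinnertonDyer-CountingDoorF2AtThree` (cell bsd-rank2; TWIN leaf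
`PAdicBSDRankTwoPositiveProportion`). Crux I1 asks, for every large subfamily `Φ` of Bhargava–Ho's
`F₂`, `Φ.AverageOnLE (fun a ↦ #Sel₃(E_a)) 36`. This file proves the LAST TWO STEPS of any
first-moment method for I1 in the shape of Bhargava–Ho 2022, §2 items (5)–(7) and Thm. 3.1(c) —
parametrisation-agnostic bookkeeping over the tree's vocabulary (`BhargavaHo2022/TwoMarkedPoints`,
`Rank2/F2DensityAlgebra`, `KummerMap`):

* §1 `AverageOnLE` algebra — `averageOnLE_add`, `averageOnLE_of_forall_le`,
  `averageOnLE_iff_forall_sum_le` (sum form `∑_{a ∈ Φ(<X)} f a ≤ (c + ε)·#Φ(<X)`, `c ≥ 0`) — and the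
  **count interface** `averageOnLE_natCard_of_card_sigma_le` / `averageOnLE_natCard_of_injective`:
  if for every `ε > 0` and all large `X` the pairs `(a, σ)`, `a ∈ Φ(<X)`, `σ ∈ S a`, inject into a
  finite type of size `≤ (c + ε)·#Φ(<X)`, then `Φ.AverageOnLE (fun a ↦ #(S a)) c` (BH22 §2 (5):
  "an asymptotic count of all irreducible orbits … of bounded height").
* §2 the **marked-point split** (BH22 Thm. 3.1(c): the irreducible locally soluble orbits are in
  bijection with pairs `(E, ξ)`, `ξ ∈ S_d(E) ∖ S'(E)`, `S'(E)` the subgroup of `S_d(E)` generated by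
  the images of the marked points under `E(ℚ)/dE(ℚ) → S_d(E)`; §2 (7): "add back … the number of
  Selmer elements … that reduce to the identity in `S'(E)`"): two elements killed by `n` generate
  `≤ n²` elements (`natCard_closure_pair_le`, via `ℤ/n × ℤ/n`), so for EVERY curve over a number
  field and the tree's Kummer map `κ = kummerMapTorsion E n` the subgroup `⟨κ P, κ Q⟩` has `≤ n²`
  elements (`natCard_closure_kummer_pair_le`) and `#Sel_n ≤ n² + #(Sel_n ∖ ⟨κ P, κ Q⟩)`
  (`natCard_selmerGroup_le_sq_add_ncard_diff`); on `F₂` at `n = 3` with the marked points: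
  `#Sel₃(E_a) ≤ 9 + #(Sel₃(E_a) ∖ S'(E_a))` (`natCard_selmerGroup_three_le_nine_add`), hence
  **I1 on `Φ` follows from an average `≤ 27` of the NON-marked `3`-Selmer classes**
  (`selmerThreeAverageLE_of_nonMarked`; Poonen–Rains split `36 = 3² + 3³`), and with §1 from an
  INJECTION of the non-marked pairs over `Φ(<X)` into finite types of size `≤ (27 + ε)·#Φ(<X)`
  (`selmerThreeAverageLE_of_injective`); `selmerThreeAverageLargeF2_of_nonMarked` /
  `selmerThreeAverageLargeF2_of_injective` conclude the route decl `SelmerThreeAverageLargeF2` BY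
  NAME from that count on every large `Φ`. No `100 %` statement (Thm. 10.1) is needed for the
  upper bound: `#S' ≤ 9` holds member by member.

Point-group algebra is done over a general field `K` (section `AnyCurve`: one decidability instance
for the tree's Kummer map and Mathlib's group law) and only APPLIED at `K = ℚ`. No named fact is used
(`kummerMapTorsion_ker`, `zsmul_geomPoints_surjective_holds`, `finite_selmerGroup_holds` are tree
theorems). The open content of I1 — a first-moment count, with average `≤ 27` over large families,
of the non-marked `3`-Selmer classes of curves with two marked points (no coregular
`θ`-parametrisation exists for `(F₂, 3)`, BH22 p. 7) — is exactly the hypothesis left standing.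
PARTITION: none — r_an ≥ 2, summit axis S0; TWIN (D-0056): n/a. B1 honesty: bookkeeping toward an
open crux; no analytic rank, no `L`-function; no S0 motion.

References: M. Bhargava, W. Ho, arXiv:2207.03309 (2022), §2 (items (5)–(7)), Thm. 3.1(c)
[BhargavaHo2022]; B. Poonen, E. Rains, J. AMS 25 (2012) (heuristic `avg #Sel_p = p^{#marked}(p+1)`)
[PoonenRains2012]; J. Silverman, AEC VIII.§2, X.4.2 (Kummer sequence) [SilvermanAEC2009].
-/

set_option linter.dupNamespace false

noncomputable section

open scoped Classical
open Filter Topology Finset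
open WeierstrassCurve Literature.NumberTheory.EllipticCurves
  Literature.NumberTheory.EllipticCurves.BhargavaHo2022
  Summit.BirchSwinnertonDyer.Rank2
  Summit.BirchSwinnertonDyer.BirchSwinnertonDyer.Theses.CountingDoorF2AtThree

namespace Summit.BirchSwinnertonDyer.BirchSwinnertonDyer.Theorems

universe w

variable (Φ : CongruenceFamily₂)

/-! ### §1 `AverageOnLE` algebra and the count interface -/

/-- Averages are additive in the integrand. [folklore] -/
theorem averageOn_add (f g : Params → ℝ) (X : ℕ) :
    Φ.averageOn (fun a ↦ f a + g a) X = Φ.averageOn f X + Φ.averageOn g X := by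
  simp only [averageOn_eq_sum_div, Finset.sum_add_distrib, add_div]

/-- `limsup avg (f + g) ≤ c + d` from `limsup avg f ≤ c` and `limsup avg g ≤ d` (ε-forms). [folklore] -/
theorem averageOnLE_add {f g : Params → ℝ} {c d : ℝ} (hf : Φ.AverageOnLE f c)
    (hg : Φ.AverageOnLE g d) : Φ.AverageOnLE (fun a ↦ f a + g a) (c + d) := fun ε hε ↦
  ((hf (ε / 2) (by linarith)).and (hg (ε / 2) (by linarith))).mono fun X hX ↦ by
    rw [averageOn_add]; linarith [hX.1, hX.2]

/-- A member-wise bound `g a ≤ c` (`c ≥ 0`) bounds every finite average by `c` (also on an empty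
height ball, where the average is the junk value `0`). [folklore] -/
theorem averageOn_le_of_forall_le {g : Params → ℝ} {c : ℝ} (hc : 0 ≤ c)
    (h : ∀ a, Φ.Mem a → g a ≤ c) (X : ℕ) : Φ.averageOn g X ≤ c := by
  rw [averageOn_eq_sum_div]
  rcases Nat.eq_zero_or_pos (Φ.below X).card with h0 | hpos
  · rw [h0, Nat.cast_zero, div_zero]; exact hc
  · rw [div_le_iff₀ (by exact_mod_cast hpos)]
    calc ∑ a ∈ Φ.below X, g a ≤ ∑ _a ∈ Φ.below X, c :=
          Finset.sum_le_sum fun a ha ↦ h a ((Φ.mem_below_iff a X).1 ha).1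
      _ = c * (Φ.below X).card := by rw [Finset.sum_const, nsmul_eq_mul, mul_comm]

/-- A member-wise bound `g a ≤ c` (`c ≥ 0`) gives `Φ.AverageOnLE g c`. [folklore] -/
theorem averageOnLE_of_forall_le {g : Params → ℝ} {c : ℝ} (hc : 0 ≤ c)
    (h : ∀ a, Φ.Mem a → g a ≤ c) : Φ.AverageOnLE g c := fun _ε hε ↦
  Filter.Eventually.of_forall fun X ↦ (averageOn_le_of_forall_le Φ hc h X).trans (by linarith)

/-- **Sum form of `AverageOnLE`** (for `c ≥ 0`): `limsup avg f ≤ c` iff for every `ε > 0`, for all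
large `X`, `∑_{a ∈ Φ(<X)} f a ≤ (c + ε) · #Φ(<X)`. (`c ≥ 0` makes the two sides agree on empty
height balls.) [folklore] -/
theorem averageOnLE_iff_forall_sum_le {f : Params → ℝ} {c : ℝ} (hc : 0 ≤ c) :
    Φ.AverageOnLE f c ↔ ∀ ε : ℝ, 0 < ε → ∀ᶠ X : ℕ in atTop,
      ∑ a ∈ Φ.below X, f a ≤ (c + ε) * (Φ.below X).card := by
  constructor
  · intro h ε hε
    refine (h ε hε).mono fun X hX ↦ ?_
    rw [averageOn_eq_sum_div] at hX
    rcases Nat.eq_zero_or_pos (Φ.below X).card with h0 | hpos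
    · rw [Finset.card_eq_zero.mp h0, Finset.sum_empty, Finset.card_empty, Nat.cast_zero, mul_zero]
    · rwa [div_le_iff₀ (by exact_mod_cast hpos)] at hX
  · intro h ε hε
    refine (h ε hε).mono fun X hX ↦ ?_
    rw [averageOn_eq_sum_div]
    rcases Nat.eq_zero_or_pos (Φ.below X).card with h0 | hpos
    · rw [h0, Nat.cast_zero, div_zero]; linarith
    · rwa [div_le_iff₀ (by exact_mod_cast hpos)]

/-- **Count interface, cardinal form.** If for every `ε > 0`, for all large `X`, the pairs
`(a, σ)` with `a ∈ Φ(<X)`, `σ ∈ S a` number at most `(c + ε) · #Φ(<X)` (`c ≥ 0`, fibres finite on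
members), then the average of `#(S a)` over `Φ` is at most `c` (`AverageOnLE`): on a height ball
`∑_a #(S a) = #Σ_a (S a)`. [folklore] -/
theorem averageOnLE_natCard_of_card_sigma_le {S : Params → Type w} {c : ℝ} (hc : 0 ≤ c)
    (hS : ∀ a, Φ.Mem a → Finite (S a))
    (h : ∀ ε : ℝ, 0 < ε → ∀ᶠ X : ℕ in atTop,
      (Nat.card (Σ a : Φ.below X, S a.1) : ℝ) ≤ (c + ε) * (Φ.below X).card) :
    Φ.AverageOnLE (fun a ↦ (Nat.card (S a) : ℝ)) c := by
  rw [averageOnLE_iff_forall_sum_le Φ hc]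
  intro ε hε
  refine (h ε hε).mono fun X hX ↦ ?_
  haveI : ∀ a : Φ.below X, Finite (S a.1) := fun a ↦ hS a.1 ((Φ.mem_below_iff a.1 X).1 a.2).1
  have hsum : ∑ a ∈ Φ.below X, Nat.card (S a) = Nat.card (Σ a : Φ.below X, S a.1) := by
    rw [Nat.card_sigma, Finset.sum_coe_sort (f := fun a ↦ Nat.card (S a))]
  rw [← Nat.cast_sum, hsum]
  exact hX

/-- **Count interface, injection form** (the shape an orbit parametrisation with a
geometry-of-numbers count delivers, BH22 §2 (5)): if for every `ε > 0` and all large `X` there is a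
finite type `β` of size `≤ (c + ε) · #Φ(<X)` and an injection of the pairs `(a, σ)`, `a ∈ Φ(<X)`,
`σ ∈ S a`, into `β`, then `Φ.AverageOnLE (fun a ↦ #(S a)) c`.
[cite: BhargavaHo2022, §2 items (5)–(7) (shape of the method)] -/
theorem averageOnLE_natCard_of_injective {S : Params → Type w} {c : ℝ} (hc : 0 ≤ c)
    (hS : ∀ a, Φ.Mem a → Finite (S a))
    (h : ∀ ε : ℝ, 0 < ε → ∀ᶠ X : ℕ in atTop, ∃ (β : Type w) (_ : Finite β)
      (ι : (Σ a : Φ.below X, S a.1) → β), Function.Injective ι ∧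
        (Nat.card β : ℝ) ≤ (c + ε) * (Φ.below X).card) :
    Φ.AverageOnLE (fun a ↦ (Nat.card (S a) : ℝ)) c := by
  refine averageOnLE_natCard_of_card_sigma_le Φ hc hS fun ε hε ↦ (h ε hε).mono ?_
  rintro X ⟨β, hβ, ι, hι, hcard⟩
  have hle : Nat.card (Σ a : Φ.below X, S a.1) ≤ Nat.card β :=
    Nat.card_le_card_of_injective ι hι
  exact le_trans (by exact_mod_cast hle) hcard

/-! ### §2 The marked-point split -/

/-- **Two elements killed by `n` generate a finite subgroup with at most `n²` elements** (`n = m`,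
`m ≥ 1` a natural number): `⟨x, y⟩` is contained in the image of `ℤ/m × ℤ/m → B`,
`(i, j) ↦ i•x + j•y`. [folklore] -/
theorem natCard_closure_pair_le {B : Type w} [AddCommGroup B] {n : ℤ} {m : ℕ} (hm : m ≠ 0)
    (hmn : (m : ℤ) = n) {x y : B} (hx : n • x = 0) (hy : n • y = 0) :
    Finite (AddSubgroup.closure ({x, y} : Set B)) ∧
      Nat.card (AddSubgroup.closure ({x, y} : Set B)) ≤ m ^ 2 := by
  haveI : NeZero m := ⟨hm⟩
  subst hmn
  let φ : ZMod m × ZMod m →+ B := (ZMod.lift m ⟨zmultiplesHom B x, by simpa using hx⟩).coprod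
    (ZMod.lift m ⟨zmultiplesHom B y, by simpa using hy⟩)
  have key : ∀ i j : ℤ, φ ((i : ZMod m), (j : ZMod m)) = i • x + j • y := fun i j ↦ by
    simp [φ, AddMonoidHom.coprod_apply, ZMod.lift_coe]
  have hle : AddSubgroup.closure ({x, y} : Set B) ≤ φ.range := by
    rw [AddSubgroup.closure_le]
    rintro z (rfl | rfl)
    · exact ⟨(((1 : ℤ) : ZMod m), ((0 : ℤ) : ZMod m)), by rw [key]; simp⟩
    · exact ⟨(((0 : ℤ) : ZMod m), ((1 : ℤ) : ZMod m)), by rw [key]; simp⟩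
  haveI hfin : Finite φ.range := Finite.of_surjective _ φ.rangeRestrict_surjective
  refine ⟨Finite.of_injective _ (AddSubgroup.inclusion_injective hle), ?_⟩
  calc Nat.card (AddSubgroup.closure ({x, y} : Set B))
      ≤ Nat.card φ.range := Nat.card_le_card_of_injective _ (AddSubgroup.inclusion_injective hle)
    _ ≤ Nat.card (ZMod m × ZMod m) := Nat.card_le_card_of_surjective _ φ.rangeRestrict_surjective
    _ = m ^ 2 := by rw [Nat.card_prod, Nat.card_zmod, sq]

section AnyCurve

variable {K : Type} [Field K] (W : WeierstrassCurve K)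

/-- For an additive map `κ` on `E(K)` killing `n·E(K)` and two points `P`, `Q`, the subgroup
generated by `κ P`, `κ Q` is finite with at most `m² = n²` elements. [folklore] -/
theorem natCard_closure_pair_le_of_map_zsmul {B : Type w} [AddCommGroup B] {n : ℤ} {m : ℕ}
    (hm : m ≠ 0) (hmn : (m : ℤ) = n) (κ : W.toAffine.Point →+ B)
    (hκ : ∀ P, κ (n • P) = 0) (P Q : W.toAffine.Point) :
    Finite (AddSubgroup.closure ({κ P, κ Q} : Set B)) ∧
      Nat.card (AddSubgroup.closure ({κ P, κ Q} : Set B)) ≤ m ^ 2 :=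
  natCard_closure_pair_le hm hmn (by rw [← map_zsmul, hκ]) (by rw [← map_zsmul, hκ])

variable [PerfectField K]

/-- The tree's Kummer map `κ : E(K) → H¹(K, E[n])` kills `n·E(K)` (its kernel IS `n·E(K)`,
`kummerMapTorsion_ker`). [cite: SilvermanAEC2009, §VIII.2 (Kummer sequence)] -/
theorem kummerMapTorsion_apply_zsmul {n : ℤ}
    (hdiv : ∀ P : W.geomPoints, ∃ Q : W.geomPoints, n • Q = P) (P : W.toAffine.Point) :
    W.kummerMapTorsion n hdiv (n • P) = 0 := by
  have hmem : n • P ∈ (W.kummerMapTorsion n hdiv).ker := by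
    rw [kummerMapTorsion_ker]; exact ⟨P, rfl⟩
  exact (AddMonoidHom.mem_ker).1 hmem

/-- **The Kummer image of two points has at most `n²` elements.** For the Kummer map
`κ : E(K) → H¹(K, E[n])` (`n = m ≥ 1`) and points `P, Q ∈ E(K)`, the subgroup `⟨κ P, κ Q⟩` — the
image of `⟨P, Q⟩`, i.e. Bhargava–Ho's `S'(E)` when `P, Q` are the marked points — is finite with at
most `m²` elements, for EVERY curve (no `100 %` statement involved).
[cite: BhargavaHo2022, Thm. 3.1(c) (definition of S'(E))] -/
theorem natCard_closure_kummer_pair_le {n : ℤ} {m : ℕ} (hm : m ≠ 0) (hmn : (m : ℤ) = n)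
    (hdiv : ∀ P : W.geomPoints, ∃ Q : W.geomPoints, n • Q = P) (P Q : W.toAffine.Point) :
    Finite (AddSubgroup.closure
        ({W.kummerMapTorsion n hdiv P, W.kummerMapTorsion n hdiv Q} : Set (W.galH1Torsion n))) ∧
      Nat.card (AddSubgroup.closure
        ({W.kummerMapTorsion n hdiv P, W.kummerMapTorsion n hdiv Q} : Set (W.galH1Torsion n))) ≤
        m ^ 2 :=
  natCard_closure_pair_le_of_map_zsmul W hm hmn (W.kummerMapTorsion n hdiv)
    (kummerMapTorsion_apply_zsmul W hdiv) P Q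

variable [NumberField K]

/-- **`#Sel_n(E) ≤ n² + #(Sel_n(E) ∖ ⟨κ P, κ Q⟩)`**: the `n`-Selmer group splits into the Kummer
image of `⟨P, Q⟩` (at most `n²` classes) and the rest. [cite: BhargavaHo2022, §2 item (7) and Thm. 3.1(c)] -/
theorem natCard_selmerGroup_le_sq_add_ncard_diff {n : ℤ} {m : ℕ} (hm : m ≠ 0) (hmn : (m : ℤ) = n)
    (hdiv : ∀ P : W.geomPoints, ∃ Q : W.geomPoints, n • Q = P) (P Q : W.toAffine.Point) :
    (Nat.card (W.selmerGroup n) : ℝ) ≤ (m : ℝ) ^ 2 +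
      ((W.selmerGroup n : Set (W.galH1Torsion n)) \
        (AddSubgroup.closure ({W.kummerMapTorsion n hdiv P, W.kummerMapTorsion n hdiv Q} :
          Set (W.galH1Torsion n)) : Set (W.galH1Torsion n))).ncard := by
  set S' : AddSubgroup (W.galH1Torsion n) := AddSubgroup.closure
    ({W.kummerMapTorsion n hdiv P, W.kummerMapTorsion n hdiv Q} : Set (W.galH1Torsion n)) with hS'
  obtain ⟨hfin, hle⟩ := natCard_closure_kummer_pair_le W hm hmn hdiv P Q
  have hsplit := Set.ncard_le_ncard_sdiff_add_ncard
    (W.selmerGroup n : Set (W.galH1Torsion n)) (S' : Set (W.galH1Torsion n)) (Set.toFinite _)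
  have hS'card : (S' : Set (W.galH1Torsion n)).ncard ≤ m ^ 2 := by
    rw [← Nat.card_coe_set_eq]; exact hle
  have h1 : Nat.card (W.selmerGroup n) = (W.selmerGroup n : Set (W.galH1Torsion n)).ncard := by
    rw [← Nat.card_coe_set_eq]; rfl
  have h2 : ((W.selmerGroup n : Set (W.galH1Torsion n)).ncard : ℝ) ≤
      ((W.selmerGroup n : Set (W.galH1Torsion n)) \ (S' : Set (W.galH1Torsion n))).ncard +
        (S' : Set (W.galH1Torsion n)).ncard := by
    exact_mod_cast hsplit
  have h3 : ((S' : Set (W.galH1Torsion n)).ncard : ℝ) ≤ (m : ℝ) ^ 2 := by exact_mod_cast hS'card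
  rw [h1]; linarith

end AnyCurve

/-! ### §2b The split on `F₂`: `#Sel₃(E_a) ≤ 9 + #(Sel₃(E_a) ∖ S'(E_a))`, and I1 from the non-marked count -/

/-- For a member `a` of `F₂`, multiplication by `3` on `E_a(ℚ̄)` is onto (the curve is elliptic;
tree theorem `zsmul_geomPoints_surjective_holds`) — the datum the tree's Kummer map at `n = 3` takes.
[cite: SilvermanAEC2009, §VIII.2] -/
theorem three_zsmul_geomPoints_surjective {a : Params} (h : a.IsMember) :
    ∀ P : a.curve.geomPoints, ∃ Q : a.curve.geomPoints, (3 : ℤ) • Q = P := by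
  haveI := Params.isElliptic_curve h
  exact zsmul_geomPoints_surjective_holds a.curve (by norm_num)

/-- **`#Sel₃(E_a) ≤ 9 + #(Sel₃(E_a) ∖ S'(E_a))` for every member** `a` of `F₂`, where
`S'(E_a) = ⟨κ P₁, κ P₂⟩` is the subgroup of `H¹(ℚ, E_a[3])` generated by the Kummer images of the
marked points `P₁ = (a₂, 0)`, `P₂ = (a₂', 0)` (Bhargava–Ho's `S'(E)`), of size `≤ 9`.
[cite: BhargavaHo2022, Thm. 3.1(c) and §2 item (7)] -/
theorem natCard_selmerGroup_three_le_nine_add {a : Params} (h : a.IsMember)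
    (hdiv : ∀ P : a.curve.geomPoints, ∃ Q : a.curve.geomPoints, (3 : ℤ) • Q = P) :
    (Nat.card (a.curve.selmerGroup 3) : ℝ) ≤ 9 +
      ((a.curve.selmerGroup 3 : Set (a.curve.galH1Torsion 3)) \
        (AddSubgroup.closure ({a.curve.kummerMapTorsion 3 hdiv (Params.markedPoint₁ h),
            a.curve.kummerMapTorsion 3 hdiv (Params.markedPoint₂ h)} :
          Set (a.curve.galH1Torsion 3)) : Set (a.curve.galH1Torsion 3))).ncard := by
  have h9 := natCard_selmerGroup_le_sq_add_ncard_diff a.curve (n := 3) (m := 3) (by norm_num)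
    (by norm_num) hdiv (Params.markedPoint₁ h) (Params.markedPoint₂ h)
  norm_num at h9; exact h9

/-- **I1 on `Φ` from a count of the non-marked `3`-Selmer elements** (the split `36 = 9 + 27`).
If a function `g` dominates, on every member `a` of `Φ`, the number of `3`-Selmer elements of `E_a`
outside `S'(E_a) = ⟨κ P₁, κ P₂⟩` (the Kummer images of the marked points), and `Φ.AverageOnLE g 27`,
then `Φ.AverageOnLE (fun a ↦ #Sel₃(E_a)) 36`. (BH22 §2 (7): count the irreducible orbits, then
"add back" the `≤ 9` marked classes per curve.) [cite: BhargavaHo2022, §2 item (7) and Thm. 3.1(c)] -/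
theorem selmerThreeAverageLE_of_nonMarked {g : Params → ℝ} (hg : Φ.AverageOnLE g 27)
    (hle : ∀ a, Φ.Mem a → ∀ (h : a.IsMember)
      (hdiv : ∀ P : a.curve.geomPoints, ∃ Q : a.curve.geomPoints, (3 : ℤ) • Q = P),
      (((a.curve.selmerGroup 3 : Set (a.curve.galH1Torsion 3)) \
        (AddSubgroup.closure ({a.curve.kummerMapTorsion 3 hdiv (Params.markedPoint₁ h),
            a.curve.kummerMapTorsion 3 hdiv (Params.markedPoint₂ h)} :
          Set (a.curve.galH1Torsion 3)) : Set (a.curve.galH1Torsion 3))).ncard : ℝ) ≤ g a) :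
    Φ.AverageOnLE (fun a ↦ (Nat.card (a.curve.selmerGroup 3) : ℝ)) 36 := by
  have h36 : (36 : ℝ) = 9 + 27 := by norm_num
  rw [h36]
  have hsum : Φ.AverageOnLE (fun a ↦ (9 : ℝ) + g a) (9 + 27) :=
    averageOnLE_add Φ (averageOnLE_of_forall_le Φ (by norm_num) fun _ _ ↦ le_rfl) hg
  refine averageOnLE_mono Φ hsum fun a ha ↦ ?_
  have h : a.IsMember := ha.1
  have hdiv := three_zsmul_geomPoints_surjective h
  have h9 := natCard_selmerGroup_three_le_nine_add h hdiv
  linarith [hle a ha h hdiv]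

/-- **The route decl I1 from the non-marked count on every large `Φ`.** If for every large
subfamily `Φ` of `F₂` some `g` with `Φ.AverageOnLE g 27` dominates member-wise the number of
`3`-Selmer elements outside `S'(E_a) = ⟨κ P₁, κ P₂⟩`, then `SelmerThreeAverageLargeF2` holds
(concluded BY NAME). The hypothesis is the open content of I1 (a first-moment count, with average
`≤ 27 = 3³`, of the non-marked `3`-Selmer elements of curves with two marked points — Bhargava–Ho
prove the `2`-Selmer analogue via `2 ⊗ 2 ⊗ 2 ⊗ 2`). [cite: BhargavaHo2022, Thm. 1.1/1.2 (the 2-Selmer analogue) and §2 item (7)] -/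
theorem selmerThreeAverageLargeF2_of_nonMarked
    (H : ∀ Φ : CongruenceFamily₂, Φ.IsLarge → ∃ g : Params → ℝ, Φ.AverageOnLE g 27 ∧
      ∀ a, Φ.Mem a → ∀ (h : a.IsMember)
        (hdiv : ∀ P : a.curve.geomPoints, ∃ Q : a.curve.geomPoints, (3 : ℤ) • Q = P),
        (((a.curve.selmerGroup 3 : Set (a.curve.galH1Torsion 3)) \
          (AddSubgroup.closure ({a.curve.kummerMapTorsion 3 hdiv (Params.markedPoint₁ h),
              a.curve.kummerMapTorsion 3 hdiv (Params.markedPoint₂ h)} :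
            Set (a.curve.galH1Torsion 3)) : Set (a.curve.galH1Torsion 3))).ncard : ℝ) ≤ g a) :
    SelmerThreeAverageLargeF2 := by
  intro Φ hΦ
  obtain ⟨g, hg, hle⟩ := H Φ hΦ
  exact selmerThreeAverageLE_of_nonMarked Φ hg hle

/-! ### §2c The count interface for I1: injecting the non-marked `3`-Selmer pairs -/

/-- The set of NON-marked `3`-Selmer classes of `E_a` is finite on members: it is contained in the
finite group `Sel₃(E_a)` (AEC X.4.2(b), tree theorem `finite_selmerGroup_holds`). [cite: SilvermanAEC2009, Thm X.4.2(b)] -/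
theorem finite_nonMarkedSelmer {a : Params} (h : a.IsMember) :
    Finite {ξ : a.curve.galH1Torsion 3 | ξ ∈ a.curve.selmerGroup 3 ∧ ∀ h' : a.IsMember,
      ξ ∉ AddSubgroup.closure
        ({a.curve.kummerMapTorsion 3 (three_zsmul_geomPoints_surjective h') (Params.markedPoint₁ h'),
          a.curve.kummerMapTorsion 3 (three_zsmul_geomPoints_surjective h') (Params.markedPoint₂ h')} :
          Set (a.curve.galH1Torsion 3))} := by
  haveI := Params.isElliptic_curve h
  haveI : Finite (a.curve.selmerGroup 3) := a.curve.finite_selmerGroup_holds (by norm_num)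
  exact Set.Finite.subset (s := (a.curve.selmerGroup 3 : Set (a.curve.galH1Torsion 3)))
    (Set.toFinite _) fun ξ hξ ↦ hξ.1

/-- On a member, the set of non-marked `3`-Selmer classes IS `Sel₃(E_a) ∖ S'(E_a)` for any choice of
the (proof-irrelevant) divisibility datum of the Kummer map. [folklore] -/
theorem nonMarkedSelmer_eq_diff {a : Params} (h : a.IsMember)
    (hdiv : ∀ P : a.curve.geomPoints, ∃ Q : a.curve.geomPoints, (3 : ℤ) • Q = P) :
    {ξ : a.curve.galH1Torsion 3 | ξ ∈ a.curve.selmerGroup 3 ∧ ∀ h' : a.IsMember,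
      ξ ∉ AddSubgroup.closure
        ({a.curve.kummerMapTorsion 3 (three_zsmul_geomPoints_surjective h') (Params.markedPoint₁ h'),
          a.curve.kummerMapTorsion 3 (three_zsmul_geomPoints_surjective h') (Params.markedPoint₂ h')} :
          Set (a.curve.galH1Torsion 3))} =
    (a.curve.selmerGroup 3 : Set (a.curve.galH1Torsion 3)) \
      (AddSubgroup.closure ({a.curve.kummerMapTorsion 3 hdiv (Params.markedPoint₁ h),
          a.curve.kummerMapTorsion 3 hdiv (Params.markedPoint₂ h)} :
        Set (a.curve.galH1Torsion 3)) : Set (a.curve.galH1Torsion 3)) := by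
  ext ξ
  simp only [Set.mem_setOf_eq, Set.mem_sdiff, SetLike.mem_coe]
  exact ⟨fun hξ ↦ ⟨hξ.1, hξ.2 h⟩, fun hξ ↦ ⟨hξ.1, fun _ ↦ hξ.2⟩⟩

/-- **The count interface for I1 on one family.** If for every `ε > 0` and all large `X` the pairs
`(a, ξ)` — `a ∈ Φ(<X)`, `ξ` a `3`-Selmer class of `E_a` OUTSIDE the marked subgroup
`S'(E_a) = ⟨κ P₁, κ P₂⟩` (BH22 Thm. 3.1(c): these are the pairs an orbit parametrisation sees as
irreducible orbits) — inject into a finite type of size `≤ (27 + ε) · #Φ(<X)`, then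
`Φ.AverageOnLE (fun a ↦ #Sel₃(E_a)) 36`. [cite: BhargavaHo2022, Thm. 3.1(c) and §2 items (5)–(7)] -/
theorem selmerThreeAverageLE_of_injective
    (H : ∀ ε : ℝ, 0 < ε → ∀ᶠ X : ℕ in atTop, ∃ (β : Type) (_ : Finite β)
      (ι : (Σ a : Φ.below X, {ξ : a.1.curve.galH1Torsion 3 | ξ ∈ a.1.curve.selmerGroup 3 ∧
        ∀ h' : a.1.IsMember, ξ ∉ AddSubgroup.closure
          ({a.1.curve.kummerMapTorsion 3 (three_zsmul_geomPoints_surjective h')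
              (Params.markedPoint₁ h'),
            a.1.curve.kummerMapTorsion 3 (three_zsmul_geomPoints_surjective h')
              (Params.markedPoint₂ h')} : Set (a.1.curve.galH1Torsion 3))}) → β),
      Function.Injective ι ∧ (Nat.card β : ℝ) ≤ (27 + ε) * (Φ.below X).card) :
    Φ.AverageOnLE (fun a ↦ (Nat.card (a.curve.selmerGroup 3) : ℝ)) 36 := by
  have hg := averageOnLE_natCard_of_injective Φ (c := 27) (by norm_num)
    (S := fun a : Params ↦ {ξ : a.curve.galH1Torsion 3 | ξ ∈ a.curve.selmerGroup 3 ∧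
        ∀ h' : a.IsMember, ξ ∉ AddSubgroup.closure
          ({a.curve.kummerMapTorsion 3 (three_zsmul_geomPoints_surjective h')
              (Params.markedPoint₁ h'),
            a.curve.kummerMapTorsion 3 (three_zsmul_geomPoints_surjective h')
              (Params.markedPoint₂ h')} : Set (a.curve.galH1Torsion 3))})
    (fun a ha ↦ finite_nonMarkedSelmer ha.1) H
  refine selmerThreeAverageLE_of_nonMarked Φ hg fun a _ h hdiv ↦ ?_
  rw [← nonMarkedSelmer_eq_diff h hdiv, ← Nat.card_coe_set_eq]

/-- **The count interface for the route decl I1** (`SelmerThreeAverageLargeF2`, BY NAME): it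
suffices to inject, for every large `Φ ⊆ F₂`, every `ε > 0` and all large `X`, the non-marked
`3`-Selmer pairs `(a, ξ)` over `Φ(<X)` into finite types of size `≤ (27 + ε) · #Φ(<X)` — the
first-moment count a parametrisation of the `3`-Selmer elements of curves with two marked points
would deliver (none by a coregular `θ`-representation exists for `(F₂, 3)`, BH22 p. 7; this is the
crux's open content). [cite: BhargavaHo2022, Thm. 1.1/1.2 (2-Selmer analogue), Thm. 3.1(c), §2 (5)–(7)] -/
theorem selmerThreeAverageLargeF2_of_injective
    (H : ∀ Φ : CongruenceFamily₂, Φ.IsLarge → ∀ ε : ℝ, 0 < ε → ∀ᶠ X : ℕ in atTop,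
      ∃ (β : Type) (_ : Finite β)
      (ι : (Σ a : Φ.below X, {ξ : a.1.curve.galH1Torsion 3 | ξ ∈ a.1.curve.selmerGroup 3 ∧
        ∀ h' : a.1.IsMember, ξ ∉ AddSubgroup.closure
          ({a.1.curve.kummerMapTorsion 3 (three_zsmul_geomPoints_surjective h')
              (Params.markedPoint₁ h'),
            a.1.curve.kummerMapTorsion 3 (three_zsmul_geomPoints_surjective h')
              (Params.markedPoint₂ h')} : Set (a.1.curve.galH1Torsion 3))}) → β),
      Function.Injective ι ∧ (Nat.card β : ℝ) ≤ (27 + ε) * (Φ.below X).card) :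
    SelmerThreeAverageLargeF2 := fun Φ hΦ ↦
  selmerThreeAverageLE_of_injective Φ (H Φ hΦ)

end Summit.BirchSwinnertonDyer.BirchSwinnertonDyer.Theorems

end
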